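import Summits.CriticalPhenomena.PercolationContinuityZ3.Theorems.PercNearOneGluingNoHeavyQuantFarTwoArmLevel
import HarnessLib

/-!
# QUANT lane R8: the factor `2` in FAR's mean hypothesis is SHARP, even for relay sets with `|A| ≥ 2j + 1` —
# census-1 g6's two-arm tree family in the kernel, via the tree cluster-law transfer

builds on p205010 (kernel theorem, internal audit signed; external expert review pending)

Support file (`--supports stmt-CriticalPhenomena-4575`), QUANT lane typer seat prim-quant-stmt (gen 9), typer brief item (c) ('refuted variants
recorded as negations').  Inputs: `…QuantFarTwoArmLevel.lean` (`QuantCensus.twoArm_level_ge`, `upow_le`, `card_filter_val_Icc`) and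
`…QuantTreeClusterTransfer.lean` (p219638: `Quant.tree_relayCount_transfer`, `Quant.tree_real_openConn_eq_prod`).  Memo:
`run/shared/lean/prim/quant/CENSUS-GAIN.md` §14.7 (census-1 g6: `θ(j) ≥ (2j+1)j/(j+1)`, FAR's factor 2 asymptotically sharp on trees),
`STATEMENTS.md` §K.  Theorems only; no definitions (the witness family is built inside the proof), no named facts, no sorries, no certificates;
standard axioms.

`Quant.FarRelayRow` (FAR): `2j < Σ_{a∈A} P(o ↔ a)` and `P(o ↮ a) ≤ t` on `A` imply `P(#{a ∈ A | o ↔ a} ≤ j) ≤ t`.  Can the constant `2` be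
lowered?  Trivially not without a normalisation (two glued `j`-blocks behind equal gates `g`: `EN = 2jg`, `P(N ≤ j) = 1 − g² > 1 − g`), so the
honest question asks for `|A| ≥ 2j + 1`.  `QuantCensus.farRelayRow_hypothesis_witness` (p215180: `c = 149/100`, `j = 1`) and
`QuantCensus.farRelayRow_hypothesis_witness_layerTwo` (`c = 81/50`, `j = 2`) are finite certificates; here the whole family is treated symbolically.

**The two-arm tree `T_k`** (`2k + 5` vertices, layer `j = k + 1`): observer `0`; a hub `1` behind a gate of weight `g`, carrying `k + 2` leaf relays
`3, …, k+4` at weight `u`; a gateway relay `2` behind a gate of weight `g`, carrying `k` relays `k+5, …, 2k+4` glued to it (weight `1`); `A` = all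
vertices of value `≥ 2` (`|A| = 2k + 3 = 2j + 1`).  With `g = k/(k+2)`, `u = (k+2)²/((k+2)²+1)`: every relay has `P(o ↔ a) ≥ g·u`
(`Quant.tree_real_openConn_eq_prod`), so `EN ≥ (2k+3)·g·u = 2k − 1 + 5/((k+2)²+1)` and `max_a P(o ↮ a) ≤ 1 − gu =: t`; and
`P(N ≤ k+1) ≥ g(1−g) + (1−g)(1 − g·u^{k+2})` (`Quant.tree_relayCount_transfer` + `twoArm_level_ge`)
`≥ g(1−g) + (1−g)(1 − g(k+2)/(k+3)) = t + (k³+3k²+4k)/((k+2)²(k+3)((k+2)²+1)) > t` (`upow_le`).  Since `EN/j → 2`: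

* `QuantCensus.farRelayRow_factor_two_sharp` — **for every `c < 2` it is NOT true that, on every finite weighted graph, `2j+1 ≤ |A|`,
  `c·j < Σ_a P(o ↔ a)` and `P(o ↮ a) ≤ t` on `A` imply `P(N ≤ j) ≤ t`.**  FAR's `2j` is the sharp threshold in its own shape (on trees),
  as census-1 g6 found numerically (the family is theirs; `g, u` are chosen here for a clean proof).
[cite: KozmaNitzan2024, Lemma 2 (p. 6), Conjecture 3 (p. 15)]
-/

noncomputable section

namespace Summit.CriticalPhenomena.PercolationContinuityZ3.Theorems

namespace QuantCensus

open Finset MeasureTheory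
open Literature.Probability.LatticeModels
open Literature.Probability.Percolation
open scoped Classical

/-- **FAR's factor `2` is sharp, even with `|A| ≥ 2j + 1`.**  For every `c < 2` it is NOT the case that on every finite weighted graph
`2j + 1 ≤ |A|`, `c·j < Σ_{a∈A} P(o ↔ a)` and `P(o ↮ a) ≤ t` (`a ∈ A`) imply `P(#{a ∈ A | o ↔ a} ≤ j) ≤ t`: the two-arm trees `T_k`
(gate `k/(k+2)` to a hub with `k+2` leaves at weight `(k+2)²/((k+2)²+1)`, gate `k/(k+2)` to a glued block of `k+1` relays; `j = k+1`,
`|A| = 2j+1`) violate it with `EN/j → 2`.  Census-1 g6's threshold family (CENSUS-GAIN §14.7), computed symbolically through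
`Quant.tree_relayCount_transfer`. builds on p205010 (kernel theorem, internal audit signed; external expert review pending). [this work] -/
theorem farRelayRow_factor_two_sharp (c : ℝ) (hc : c < 2) :
    ¬ ∀ (n : ℕ) (w : Sym2 (Fin n) → unitInterval) (A : Finset (Fin n)) (o : Fin n) (j : ℕ) (t : ℝ),
      2 * j + 1 ≤ A.card →
      (c * j : ℝ) < ∑ a ∈ A, (prodBernoulli w).real (openConn o a) →
      (∀ a ∈ A, (prodBernoulli w).real (openConn o a)ᶜ ≤ t) →
      (prodBernoulli w).real {ω : BondConfig (Fin n) | (A.filter fun a => ω ∈ openConn o a).card ≤ j} ≤ t := by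
  intro h
  -- choose the size parameter `k ≥ 1` with `c (k + 1) < 2k − 1`
  obtain ⟨k₀, hk₀⟩ := exists_nat_gt ((1 + c) / (2 - c))
  set k : ℕ := max k₀ 1 with hk
  have hk1 : 1 ≤ k := le_max_right _ _
  have hkc : c * ((k : ℝ) + 1) < 2 * k - 1 := by
    have h2c : 0 < 2 - c := by linarith
    have hk' : (1 + c) / (2 - c) < k := lt_of_lt_of_le hk₀ (by exact_mod_cast le_max_left k₀ 1)
    rw [div_lt_iff₀ h2c] at hk'
    nlinarith
  -- the parameters
  set gR : ℝ := (k : ℝ) / ((k : ℝ) + 2) with hgR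
  set uR : ℝ := ((k : ℝ) + 2) ^ 2 / (((k : ℝ) + 2) ^ 2 + 1) with huR
  have hg0 : 0 ≤ gR := by rw [hgR]; positivity
  have hg1 : gR ≤ 1 := by rw [hgR, div_le_one (by positivity)]; linarith
  have hu0 : 0 ≤ uR := by rw [huR]; positivity
  have hu1 : uR ≤ 1 := by rw [huR, div_le_one (by positivity)]; linarith
  set g : unitInterval := ⟨gR, hg0, hg1⟩ with hgdef
  set u : unitInterval := ⟨uR, hu0, hu1⟩ with hudef
  have hgc : ((g : unitInterval) : ℝ) = gR := rfl
  have huc : ((u : unitInterval) : ℝ) = uR := rfl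
  -- the tree `T_k` on `Fin (2k+5)` in coordinates
  set vo : Fin (2 * k + 5) := ⟨0, by omega⟩ with hvo
  set vh : Fin (2 * k + 5) := ⟨1, by omega⟩ with hvh
  set vb : Fin (2 * k + 5) := ⟨2, by omega⟩ with hvb
  set par : Fin (2 * k + 5) → Fin (2 * k + 5) :=
    fun x => if x.val ≤ 2 then vo else if x.val ≤ k + 4 then vh else vb with hpar
  set depth : Fin (2 * k + 5) → ℕ := fun x => if x.val ≤ 2 then 0 else 1 with hdepth
  set gate : Fin (2 * k + 5) → unitInterval :=
    fun x => if x.val = 0 then 1 else if x.val ≤ 2 then g else if x.val ≤ k + 4 then u else 1 with hgate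
  set wt : Sym2 (Fin (2 * k + 5)) → unitInterval :=
    fun e => if hh : ∃ x, x ≠ vo ∧ s(par x, x) = e then gate (Classical.choose hh) else 0 with hwt
  have par_root : ∀ x, x ≠ vo → depth x = 0 → par x = vo := by
    intro x _ hd
    by_cases hx : x.val ≤ 2
    · simp only [hpar, if_pos hx]
    · simp [hdepth, hx] at hd
  have par_step : ∀ x, x ≠ vo → depth x ≠ 0 → par x ≠ vo ∧ depth (par x) + 1 = depth x := by
    intro x _ hd
    simp only [hdepth] at hd ⊢
    by_cases hx : x.val ≤ 2
    · rw [if_pos hx] at hd; exact absurd rfl hd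
    · rw [if_neg hx]
      simp only [hpar, if_neg hx]
      by_cases hx' : x.val ≤ k + 4
      · rw [if_pos hx']
        refine ⟨fun h' => ?_, ?_⟩
        · have := congrArg Fin.val h'; simp [hvh, hvo] at this
        · simp [hvh]
      · rw [if_neg hx']
        refine ⟨fun h' => ?_, ?_⟩
        · have := congrArg Fin.val h'; simp [hvb, hvo] at this
        · simp [hvb]
  have gate_inj : ∀ {x y : Fin (2 * k + 5)}, x ≠ vo → y ≠ vo → s(par x, x) = s(par y, y) → x = y :=
    fun hx hy h' => Quant.spider_gate_injective vo (fun _ => ()) depth par par_root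
      (fun z hz hd => ⟨(par_step z hz hd).1, rfl, (par_step z hz hd).2⟩) hx hy h'
  have wt_par : ∀ x, x ≠ vo → wt s(par x, x) = gate x := by
    intro x hx
    have hex : ∃ x', x' ≠ vo ∧ s(par x', x') = s(par x, x) := ⟨x, hx, rfl⟩
    have h1 : wt s(par x, x) = gate (Classical.choose hex) := by
      simp only [hwt]; rw [dif_pos hex]
    rw [h1, gate_inj (Classical.choose_spec hex).1 hx (Classical.choose_spec hex).2]
  have wt_supp : ∀ e, wt e ≠ 0 → e.IsDiag ∨ ∃ x, x ≠ vo ∧ e = s(par x, x) := by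
    intro e he
    by_cases h' : ∃ x, x ≠ vo ∧ s(par x, x) = e
    · obtain ⟨x, hx, hxe⟩ := h'
      exact Or.inr ⟨x, hx, hxe.symm⟩
    · simp only [hwt, dif_neg h'] at he
      exact absurd rfl he
  have gateFun_eq : (fun x : Fin (2 * k + 5) => if x = vo then (1 : unitInterval) else wt s(par x, x)) = gate := by
    funext x
    by_cases hx : x = vo
    · rw [if_pos hx, hx]
      simp [hgate, hvo]
    · rw [if_neg hx, wt_par x hx]
  -- the relay sets
  set A : Finset (Fin (2 * k + 5)) := univ.filter fun a : Fin (2 * k + 5) => 2 ≤ a.val with hA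
  set L : Finset (Fin (2 * k + 5)) := univ.filter fun a : Fin (2 * k + 5) => 3 ≤ a.val ∧ a.val ≤ k + 4 with hL
  set B : Finset (Fin (2 * k + 5)) := univ.filter fun a : Fin (2 * k + 5) => k + 5 ≤ a.val ∧ a.val ≤ 2 * k + 4 with hB
  have hAcard : A.card = 2 * k + 3 := by
    have : A = univ.filter fun a : Fin (2 * k + 5) => 2 ≤ a.val ∧ a.val ≤ 2 * k + 4 := by
      rw [hA]; ext a; simp only [Finset.mem_filter, Finset.mem_univ, true_and]; omega
    rw [this, card_filter_val_Icc (2 * k + 5) 2 (2 * k + 4) (by omega)]; omega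
  have hLcard : L.card = k + 2 := by
    rw [hL, card_filter_val_Icc (2 * k + 5) 3 (k + 4) (by omega)]; omega
  have hBcard : B.card ≤ k := by
    rw [hB, card_filter_val_Icc (2 * k + 5) (k + 5) (2 * k + 4) (by omega)]; omega
  have hAmem : ∀ a ∈ A, a ≠ vo ∧ (a ∈ L ∨ a = vb ∨ a ∈ B) := by
    intro a ha
    have ha2 : 2 ≤ a.val := by simpa [hA] using ha
    refine ⟨fun h' => by rw [h'] at ha2; simp [hvo] at ha2, ?_⟩
    by_cases hgw : a.val ≤ 2
    · exact Or.inr (Or.inl (Fin.ext (by simp [hvb]; omega)))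
    · by_cases hl : a.val ≤ k + 4
      · left; simp only [hL, Finset.mem_filter, Finset.mem_univ, true_and]; omega
      · right; right; simp only [hB, Finset.mem_filter, Finset.mem_univ, true_and]; omega
  have hLpar : ∀ a ∈ L, par a = vh ∧ depth a = 1 := by
    intro a ha
    simp only [hL, Finset.mem_filter, Finset.mem_univ, true_and] at ha
    simp only [hpar, hdepth]
    rw [if_neg (by omega), if_pos (by omega), if_neg (by omega)]
    exact ⟨rfl, rfl⟩
  have hBpar : ∀ a ∈ B, par a = vb ∧ depth a = 1 := by
    intro a ha
    simp only [hB, Finset.mem_filter, Finset.mem_univ, true_and] at ha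
    simp only [hpar, hdepth]
    rw [if_neg (by omega), if_neg (by omega), if_neg (by omega)]
    exact ⟨rfl, rfl⟩
  have hbh : vb ≠ vh := fun h' => by have := congrArg Fin.val h'; simp [hvb, hvh] at this
  have hhL : vh ∉ L := by simp [hL, hvh]
  have hbL : vb ∉ L := by simp [hL, hvb]
  have hqh : ((gate vh : unitInterval) : ℝ) = gR := by simp [hgate, hvh, hgc]
  have hqb : ((gate vb : unitInterval) : ℝ) = gR := by simp [hgate, hvb, hgc]
  have hqL : ∀ a ∈ L, ((gate a : unitInterval) : ℝ) = uR := by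
    intro a ha
    simp only [hL, Finset.mem_filter, Finset.mem_univ, true_and] at ha
    simp only [hgate]
    rw [if_neg (by omega), if_neg (by omega), if_pos ha.2]
  -- marginals: every relay has `P(o ↔ a) ≥ g u`
  set μ := prodBernoulli wt with hμ
  have hmarg : ∀ a ∈ A, gR * uR ≤ μ.real (openConn vo a) := by
    intro a haA
    have ha : 2 ≤ a.val := by simpa [hA] using haA
    have hao : a ≠ vo := (hAmem a haA).1
    rw [hμ, Quant.tree_real_openConn_eq_prod (2 * k + 5) wt vo depth par par_root par_step wt_supp a hao]
    have hanc := Quant.tree_iterate_par vo depth par par_step a hao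
    have hrw : ∀ i ∈ Finset.range (depth a + 1),
        ((wt s(par (par^[i] a), par^[i] a) : unitInterval) : ℝ) = gate (par^[i] a) := by
      intro i hi
      rw [wt_par _ (hanc i (by have := Finset.mem_range.1 hi; omega)).1]
    rw [Finset.prod_congr rfl hrw]
    by_cases hleaf : a.val ≤ k + 4
    · by_cases hgw : a.val ≤ 2
      · -- the gateway `2`
        have hd : depth a = 0 := by simp [hdepth, hgw]
        rw [hd, zero_add, Finset.prod_range_one, Function.iterate_zero_apply]
        have : gate a = g := by
          simp only [hgate]; rw [if_neg (by omega), if_pos hgw]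
        rw [this, hgc]
        nlinarith
      · -- a leaf
        have hd : depth a = 1 := by simp [hdepth, hgw]
        rw [hd, Finset.prod_range_succ, Finset.prod_range_one, Function.iterate_zero_apply,
          Function.iterate_one]
        have h1 : gate a = u := by
          simp only [hgate]; rw [if_neg (by omega), if_neg hgw, if_pos hleaf]
        have h2 : par a = vh := by simp only [hpar]; rw [if_neg hgw, if_pos hleaf]
        rw [h1, h2, huc, hqh]
        linarith [mul_comm gR uR]
    · -- a block relay
      have hgw : ¬ a.val ≤ 2 := by omega
      have hd : depth a = 1 := by simp [hdepth, hgw]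
      rw [hd, Finset.prod_range_succ, Finset.prod_range_one, Function.iterate_zero_apply,
        Function.iterate_one]
      have h1 : gate a = 1 := by
        simp only [hgate]; rw [if_neg (by omega), if_neg hgw, if_neg hleaf]
      have h2 : par a = vb := by simp only [hpar]; rw [if_neg hgw, if_neg hleaf]
      rw [h1, h2, hqb]
      simp only [Set.Icc.coe_one, one_mul]
      nlinarith
  have hmeas : ∀ S : Set (BondConfig (Fin (2 * k + 5))), MeasurableSet S := fun S => (Set.toFinite S).measurableSet
  -- the three hypotheses of the (false) implication
  set t : ℝ := 1 - gR * uR with ht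
  have h1 : 2 * (k + 1) + 1 ≤ A.card := by rw [hAcard]; omega
  have h2 : (c * ((k + 1 : ℕ) : ℝ) : ℝ) < ∑ a ∈ A, μ.real (openConn vo a) := by
    have hsum : (A.card : ℝ) * (gR * uR) ≤ ∑ a ∈ A, μ.real (openConn vo a) := by
      rw [← nsmul_eq_mul, ← Finset.sum_const]
      exact Finset.sum_le_sum hmarg
    rw [hAcard] at hsum
    push_cast at hsum ⊢
    have hgu : (2 * (k : ℝ) + 3) * (gR * uR) > 2 * k - 1 := by
      have hne1 : (k : ℝ) + 2 ≠ 0 := by positivity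
      have hne2 : ((k : ℝ) + 2) ^ 2 + 1 ≠ 0 := by positivity
      have hid : (2 * (k : ℝ) + 3) * ((k : ℝ) / ((k : ℝ) + 2) * (((k : ℝ) + 2) ^ 2 / (((k : ℝ) + 2) ^ 2 + 1))) - (2 * k - 1) =
          5 / (((k : ℝ) + 2) ^ 2 + 1) := by
        field_simp
        ring
      have hfr : (0 : ℝ) < 5 / (((k : ℝ) + 2) ^ 2 + 1) := by positivity
      rw [hgR, huR]
      linarith
    linarith
  have h3 : ∀ a ∈ A, μ.real (openConn vo a)ᶜ ≤ t := by
    intro a ha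
    rw [probReal_compl_eq_one_sub (hmeas _), ht]
    linarith [hmarg a ha]
  have hinst := h (2 * k + 5) wt A vo (k + 1) t h1 h2 h3
  -- the level event is too likely: transfer to gate coordinates and the two-arm bound
  have hlevel : gR * (1 - gR) + (1 - gR) * (1 - gR * uR ^ (k + 2)) ≤
      μ.real {ω : BondConfig (Fin (2 * k + 5)) | (A.filter fun a => ω ∈ openConn vo a).card ≤ k + 1} := by
    rw [hμ, Quant.tree_relayCount_transfer (2 * k + 5) wt vo depth par par_root par_step wt_supp A (k + 1), gateFun_eq]
    exact twoArm_level_ge gate vo vh vb L B A depth par k gR uR hAmem hLpar hBpar hbh hhL hbL hLcard hBcard hqh hqb hqL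
  have hup : uR ^ (k + 2) ≤ ((k : ℝ) + 2) / ((k : ℝ) + 3) := by rw [huR]; exact upow_le k
  have hkey : t < gR * (1 - gR) + (1 - gR) * (1 - gR * uR ^ (k + 2)) := by
    have hρ : gR * (1 - gR) + (1 - gR) * (1 - gR * (((k : ℝ) + 2) / ((k : ℝ) + 3))) ≤
        gR * (1 - gR) + (1 - gR) * (1 - gR * uR ^ (k + 2)) := by
      have h1g : 0 ≤ 1 - gR := by linarith
      nlinarith [mul_le_mul_of_nonneg_left hup hg0]
    refine lt_of_lt_of_le ?_ hρ
    have hne1 : (k : ℝ) + 2 ≠ 0 := by positivity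
    have hne2 : ((k : ℝ) + 2) ^ 2 + 1 ≠ 0 := by positivity
    have hne3 : (k : ℝ) + 3 ≠ 0 := by positivity
    have hid : (k : ℝ) / ((k : ℝ) + 2) * (1 - (k : ℝ) / ((k : ℝ) + 2)) +
          (1 - (k : ℝ) / ((k : ℝ) + 2)) * (1 - (k : ℝ) / ((k : ℝ) + 2) * (((k : ℝ) + 2) / ((k : ℝ) + 3))) -
          (1 - (k : ℝ) / ((k : ℝ) + 2) * (((k : ℝ) + 2) ^ 2 / (((k : ℝ) + 2) ^ 2 + 1))) =
        ((k : ℝ) ^ 3 + 3 * k ^ 2 + 4 * k) / (((k : ℝ) + 2) ^ 2 * ((k : ℝ) + 3) * (((k : ℝ) + 2) ^ 2 + 1)) := by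
      field_simp
      ring
    have hfr : (0 : ℝ) < ((k : ℝ) ^ 3 + 3 * k ^ 2 + 4 * k) /
        (((k : ℝ) + 2) ^ 2 * ((k : ℝ) + 3) * (((k : ℝ) + 2) ^ 2 + 1)) := by positivity
    rw [ht, hgR, huR]
    linarith
  have : μ.real {ω : BondConfig (Fin (2 * k + 5)) | (A.filter fun a => ω ∈ openConn vo a).card ≤ k + 1} ≤ t := hinst
  linarith

end QuantCensus

end Summit.CriticalPhenomena.PercolationContinuityZ3.Theorems

end
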